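import Mathlib
import HarnessLib
import Summits.ValiantsHypothesis.ValiantsHypothesis.Theorems.MonotoneRestorationMixingScaleSpechtDimLinear

/-!
# Equivariant dial layers — Specht dimensions in depth `≤ 2` (lower bounds)

Support file B1 of the decomposition workshop's node O-L1-13 (lineage `decomp-val-lens-1`,
representation-theoretic obstruction splitting) for the cell `EqHardBiPerm`
(`stmt-ValiantsHypothesis-23702`; leaf `EquivariantDialLayers.IdealWidthSuperpoly biPermSubst`).
It is pure tableau combinatorics and imports nothing of the Valiant cell: LOWER bounds for the number
`f^λ` of standard Young tableaux of the partitions of DEPTH `|λ| - λ₁ ≤ 2`,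

* `sub_one_le_numStandardTableaux_of_getD` : `λ₁ = m - 1` (so `λ = (m-1,1)`) gives `m - 1 ≤ f^λ`;
* `mul_le_two_mul_numStandardTableaux_of_getD` (★) : `λ₁ = m - 2`, `m ≥ 4` (so
  `λ ∈ {(m-2,2), (m-2,1,1)}`) gives `m (m - 3) ≤ 2 f^λ` (equality at `(m-2,2)`;
  `f^{(m-2,1,1)} = (m-1)(m-2)/2`),

together with the shape bookkeeping `colLen_add_rowLen_le`, `getD_sortedParts_zero_le`,
`card_parts_le_one_of_getD` (`λ₁ = m ⇒ λ = (m)`), `sortedParts_eq_of_getD` (`λ₁ = m - 1 ⇒ λ = (m-1,1)`)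
and `rowLen_zero_youngDiagram_eq` (`rowLen 0` of the diagram of `λ` is `λ₁`).

Method: the branching INEQUALITIES of the tree (`le_syt_of_isCornerRow`, `add_le_syt_of_isCornerRow`
of `SnSubsetDichotomyPolynomialSlackSpechtBranching`, public in the closure of the import) applied to the
corner of row `0` and the corner of the last row, and the hook bound `hook_two_rows_bound` /
`linear_le_syt_aux` of `MonotoneRestorationMixingScaleSpechtDimLinear`:
`f^{(m-2,2)} ≥ f^{(m-3,2)} + f^{(m-2,1)}`, `f^{(m-2,1,1)} ≥ f^{(m-3,1,1)} + f^{(m-2,1)}`.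

These numbers are consumed by file B2 (`EquivariantDialLayersSuperlinear`): the sixteen possible
types `λ ⊠ μ`, `λ, μ ∈ {(m), (m-1,1), (m-2,2), (m-2,1,1)}`, of a quadric under `𝔖_m × 𝔖_m`
(file A, `EquivariantDialLayersQuadricTypes`) have dimensions `f^λ f^μ` bounded below by these.
Nothing here is specific to Valiant's hypothesis; no statement about `VP ≠ VNP` is made or implied.

References: [cite: JamesLNM682, §9 (branching rule)]; [cite: FultonYoungTableaux1997, §7.2].
-/

set_option linter.dupNamespace false

namespace Summit.ValiantsHypothesis.ValiantsHypothesis.Theorems.EquivariantDialLayersSpechtDepth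

open Literature.NumberTheory.DiophantineGeometry Literature.RepresentationTheory.FiniteGroups
open Summit.MatrixMultiplication.MatrixMultiplication.Theorems.PolynomialSlack
open Summit.ValiantsHypothesis.ValiantsHypothesis.Theorems.OrbitRestorationQPMixingScale.SpechtDim

variable {m : ℕ}

/-! ## §1 Diagrams: the hook `(k,1)` and the two depth-two shapes -/

/-- `colLen 0 + rowLen 0 ≤ |Y| + 1` (the first row and the first column share one cell). [folklore] -/
theorem colLen_add_rowLen_le (Y : YoungDiagram) : Y.colLen 0 + Y.rowLen 0 ≤ Y.cells.card + 1 := by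
  rw [YoungDiagram.rowLen_eq_card, YoungDiagram.colLen_eq_card]
  have hu : Y.col 0 ∪ Y.row 0 ⊆ Y.cells := by
    intro c hc
    rcases Finset.mem_union.1 hc with h | h
    · exact (YoungDiagram.mem_cells _).2 (YoungDiagram.mem_col_iff.1 h).1
    · exact (YoungDiagram.mem_cells _).2 (YoungDiagram.mem_row_iff.1 h).1
  have hi : (Y.col 0 ∩ Y.row 0).card ≤ 1 := by
    refine Finset.card_le_one.2 fun a ha b hb => ?_
    rw [Finset.mem_inter, YoungDiagram.mem_col_iff, YoungDiagram.mem_row_iff] at ha hb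
    exact Prod.ext (ha.2.2.trans hb.2.2.symm) (ha.1.2.trans hb.1.2.symm)
  have h1 := Finset.card_union_add_card_inter (Y.col 0) (Y.row 0)
  have h2 := Finset.card_le_card hu
  omega

/-- The hook `(k, 1)`: `|Y| - 1 ≤ f^Y` when the first row misses exactly one cell (the tree's
`hook_two_rows_bound` fed with `linear_le_syt_aux`; the cases `|Y| ≤ 2` by `1 ≤ f^Y`). [folklore] -/
theorem card_le_syt_succ_of_rowLen {Y : YoungDiagram} (h : Y.rowLen 0 + 1 = Y.cells.card) :
    Y.cells.card ≤ Nat.card (StdFilling Y.cells.card Y) + 1 := by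
  have hf := one_le_card_stdFilling Y
  by_cases h2 : Y.cells.card ≤ 2
  · omega
  · have hcr := colLen_add_rowLen_le Y
    exact hook_two_rows_bound Y.cells.card (fun m' _ Y' h1 h2 h3 => linear_le_syt_aux m' Y' h1 h2 h3) Y
      rfl h (by omega)

/-- ★ Depth two: `|Y|(|Y| - 3) ≤ 2 f^Y` for every diagram with exactly two cells below its first row
(`|Y| ≥ 4`; equality at `(m-2,2)`, and `f^{(m-2,1,1)} = (m-1)(m-2)/2`).  Branching induction: the corners of
row `0` and of the last row give `f^{(m-2,2)} ≥ f^{(m-3,2)} + f^{(m-2,1)}` etc.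
[cite: JamesLNM682, §9 (branching rule)] -/
theorem mul_le_two_mul_syt_of_rowLen : ∀ (m : ℕ) (Y : YoungDiagram), Y.cells.card = m → 4 ≤ m →
    Y.rowLen 0 + 2 = m → m * (m - 3) ≤ 2 * Nat.card (StdFilling Y.cells.card Y) := by
  intro m
  induction m using Nat.strong_induction_on with
  | _ m ih =>
    intro Y hY h4 hrow
    have hcr := colLen_add_rowLen_le Y
    have hc2 : 2 ≤ Y.colLen 0 := by
      by_contra hlt
      have := card_eq_rowLen_of_colLen_le_one (Y := Y) (by omega)
      omega
    -- the corner of the last row `r₁ = colLen 0 - 1 ∈ {1, 2}`; the child `Z₁ = Y ⊖ c₁` is the hook with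
    -- `|Y| - 1` cells and first row `|Y| - 2`
    have hlast := isCornerRow_last (Y := Y) (by omega)
    obtain ⟨n, rfl⟩ : ∃ n, m = n + 1 := ⟨m - 1, by omega⟩
    have hZ₁c := card_removeAbove_cornerCell hlast hY
    have hZ₁r : (Y.removeAbove ((Y.colLen 0 - 1, Y.rowLen (Y.colLen 0 - 1) - 1))).rowLen 0 = Y.rowLen 0 :=
      rowLen_removeAbove_cornerCell_of_ne hlast (by omega)
    have hZ₁ := card_le_syt_succ_of_rowLen
      (Y := Y.removeAbove ((Y.colLen 0 - 1, Y.rowLen (Y.colLen 0 - 1) - 1))) (by rw [hZ₁r, hZ₁c]; omega)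
    by_cases h5 : n + 1 = 4
    · -- `|Y| = 4`: `f^Y ≥ f^{Z₁} ≥ 2`
      have hle := le_syt_of_isCornerRow hlast
      obtain rfl : n = 3 := by omega
      omega
    · -- `|Y| ≥ 5`: row `0` (of length `|Y| - 2 ≥ 3 > 2 ≥ rowLen 1`) is a corner row as well; its child
      -- `Z₀ = Y ⊖ c₀` has `|Y| - 1` cells and first row `|Y| - 3`: induction
      have hsum := card_eq_sum_rowLen Y
      have h1 : Y.rowLen 1 ≤ 2 := by
        rcases (show Y.colLen 0 = 2 ∨ Y.colLen 0 = 3 by omega) with hc | hc <;> rw [hc] at hsum <;>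
          simp only [Finset.sum_range_succ, Finset.sum_range_zero, zero_add] at hsum <;> omega
      have h0 : Y.rowLen (0 + 1) < Y.rowLen 0 := by show Y.rowLen 1 < Y.rowLen 0; omega
      have hadd := add_le_syt_of_isCornerRow h0 hlast (by omega)
      have hZ₀c := card_removeAbove_cornerCell h0 hY
      have hZ₀r := rowLen_removeAbove_cornerCell_self h0
      obtain ⟨k, rfl⟩ : ∃ k, n = k + 4 := ⟨n - 4, by omega⟩
      have hih := ih (k + 4) (by omega) _ hZ₀c (by omega) (by rw [hZ₀r]; omega)
      have hid : (k + 4 + 1) * (k + 4 + 1 - 3) = (k + 4) * (k + 4 - 3) + 2 * (k + 4 - 1) := by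
        rw [show k + 4 + 1 - 3 = k + 2 from by omega, show k + 4 - 3 = k + 1 from by omega,
          show k + 4 - 1 = k + 3 from by omega]
        ring
      rw [hid]
      omega

/-! ## §2 Partitions: `λ₁` and the shapes of depth `0` and `1` -/

/-- `λ₁ ≤ m`. [folklore] -/
theorem getD_sortedParts_zero_le (la : Nat.Partition m) : la.sortedParts.getD 0 0 ≤ m := by
  have hsum := la.sum_sortedParts
  rcases hL : la.sortedParts with _ | ⟨x, l⟩
  · rw [List.getD_nil]; exact Nat.zero_le _
  · rw [hL, List.sum_cons] at hsum
    rw [List.getD_cons_zero]; omega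

/-- `λ₁ = m` iff `λ = (m)`: then `λ` has at most one part. [folklore] -/
theorem card_parts_le_one_of_getD (la : Nat.Partition m) (h : la.sortedParts.getD 0 0 = m) :
    la.parts.card ≤ 1 := by
  rw [← la.length_sortedParts]
  have hsum := la.sum_sortedParts
  have hpos : ∀ a ∈ la.sortedParts, 0 < a := fun a ha => la.pos_of_mem_sortedParts ha
  rcases hL : la.sortedParts with _ | ⟨x, _ | ⟨y, l⟩⟩
  · simp
  · simp
  · exfalso
    rw [hL, List.sum_cons, List.sum_cons] at hsum
    rw [hL, List.getD_cons_zero] at h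
    rw [hL] at hpos
    have hy := hpos y (by simp)
    omega

/-- `λ₁ = m - 1` forces `λ = (m-1, 1)`. [folklore] -/
theorem sortedParts_eq_of_getD (la : Nat.Partition m) (h : la.sortedParts.getD 0 0 + 1 = m) :
    la.sortedParts = [m - 1, 1] := by
  have hsum := la.sum_sortedParts
  have hpos : ∀ a ∈ la.sortedParts, 0 < a := fun a ha => la.pos_of_mem_sortedParts ha
  rcases hL : la.sortedParts with _ | ⟨x, _ | ⟨y, _ | ⟨z, l⟩⟩⟩
  · exfalso
    rw [hL, List.sum_nil] at hsum
    rw [hL, List.getD_nil] at h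
    omega
  · exfalso
    rw [hL, List.sum_cons, List.sum_nil] at hsum
    rw [hL, List.getD_cons_zero] at h
    omega
  · rw [hL, List.sum_cons, List.sum_cons, List.sum_nil] at hsum
    rw [hL, List.getD_cons_zero] at h
    rw [show x = m - 1 from by omega, show y = 1 from by omega]
  · exfalso
    rw [hL, List.sum_cons, List.sum_cons, List.sum_cons] at hsum
    rw [hL, List.getD_cons_zero] at h
    rw [hL] at hpos
    have hy := hpos y (by simp)
    have hz := hpos z (by simp)
    omega

/-- `rowLen 0` of the diagram of `λ` is `λ₁`. [folklore] -/
theorem rowLen_zero_youngDiagram_eq (la : Nat.Partition m) :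
    la.youngDiagram.rowLen 0 = la.sortedParts.getD 0 0 := by
  rcases Nat.eq_zero_or_pos (la.youngDiagram.colLen 0) with h | h
  · have hl : la.sortedParts = [] :=
      List.eq_nil_of_length_eq_zero (by rw [la.length_sortedParts, ← colLen_zero_youngDiagram la, h])
    rw [VershikKerov.rowLen_eq_zero _ (by omega), hl, List.getD_nil]
  · have h1 := head?_rowLens h
    rw [la.rowLens_youngDiagram] at h1
    rcases hL : la.sortedParts with _ | ⟨x, l⟩
    · rw [hL] at h1
      simp at h1
    · rw [hL, List.head?_cons, Option.some.injEq] at h1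
      rw [List.getD_cons_zero, h1]

/-! ## §3 Partitions: the bounds for `f^λ` in depth `1` and `2` -/

/-- `f^{(m-1,1)} ≥ m - 1` (in fact `=`). [folklore] -/
theorem sub_one_le_numStandardTableaux_of_getD (la : Nat.Partition m) (h : la.sortedParts.getD 0 0 + 1 = m) :
    m - 1 ≤ numStandardTableaux la := by
  rw [numStandardTableaux_eq_card_stdFilling']
  have hc := la.card_cells_youngDiagram
  have hr := rowLen_zero_youngDiagram_eq la
  have key := card_le_syt_succ_of_rowLen (Y := la.youngDiagram) (by rw [hr, hc]; exact h)
  omega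

/-- ★ `m(m-3) ≤ 2 f^λ` for `λ ∈ {(m-2,2), (m-2,1,1)}`, `m ≥ 4`. [cite: JamesLNM682, §9 (branching rule)] -/
theorem mul_le_two_mul_numStandardTableaux_of_getD (hm : 4 ≤ m) (la : Nat.Partition m)
    (h : la.sortedParts.getD 0 0 + 2 = m) : m * (m - 3) ≤ 2 * numStandardTableaux la := by
  rw [numStandardTableaux_eq_card_stdFilling']
  have hc := la.card_cells_youngDiagram
  have hr := rowLen_zero_youngDiagram_eq la
  exact mul_le_two_mul_syt_of_rowLen m la.youngDiagram hc hm (by rw [hr]; exact h)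

end Summit.ValiantsHypothesis.ValiantsHypothesis.Theorems.EquivariantDialLayersSpechtDepth
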